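import Summits.Ventures.CertifiedArithmetic.LowPrec.EnvelopeAtoms

/-!
# The SHARP stochastic-rounding variance atom `u²/(1+2u)` (lemma L8 `SRRelVarSharp`)

HONEST FRAMING (venture CertifiedArithmetic / cell `pub-lowprec`): certified error envelopes and
provably optimal rounding/accumulation schemes for low-precision formats under stated cost models;
every table by two implementations; no hardware or vendor claims.

The cell's predicted-MSE table for stochastic-rounding configurations (`envelope/THEOREM-SHAPES.md`
v4 §4.4 C-f / §4.5, certificate C57 `certs/enum/ENVELOPE-SR-ATOMS.json`: 9 schemes × 18 binades ×
2 atoms, two exact routes agreeing with the closed form on all 97 all-normal cells) rests on ONE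
per-element constant: the worst relative variance of unbiased stochastic rounding into a format on
its normal range.  The tree had the coarse level `u² · x²` (`mx_var_le`, from the spacing law
`gap ≤ 2u·|x|` and `V ≤ gap²/4`, [ArarEtAl2023, §3]); the SHARP constant is

  `Var SR_φ(x) = (x − ↓x)(↑x − x) ≤ u²/(1+2u) · x²`   for `2^m·quantum ≤ |x| ≤ maxRat`,

with equality exactly at `|x| = 2^E (1+2u)/(1+u)` (the harmonic mean of the first cell of a binade —
NOT a dyadic point, which is why the exhaustive bfloat16 route of C57 falls strictly short of it on
every power-of-two-scaled cell).  Values: E4M3 `1/288`, E5M2 `1/80`, E2M1 `1/24` (against the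
squared round-to-nearest atom `(u/(1+u))² = 1/289, 1/81, 1/25`: for every format the worst relative
MSE of SR exceeds the worst squared relative error of RNE, `(u/(1+u))² < u²/(1+2u)`).

Contents:
* `Format.sub_rdGrid_mul_ruGrid_sub_le_sharp` — the inequality on the magnitude grid
  (`2^m ≤ r ≤ maxScaled`): `(r − rdGrid r)(ruGrid r − r) ≤ u²/(1+2u) · r²`; proof: the binade floor
  `g = 2^(m+s)` is representable, so `g ≤ rdGrid r =: d`, the gap is `≤ 2^s = 2u·g ≤ 2u·d`, and with
  `a = r − d`, `b = ruGrid r − r`, `a + b ≤ 2ud`:  `u²(d+a)² − (1+2u)ab = (ud − (1+u)a)² + (1+2u)a(2ud − a − b) ≥ 0`.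
* `MiniFloat.srVar_le_sharp` — the datum-level statement for `ConnollyHighamMary2021.srVar` over
  `valueSet φ` (both signs, via the bridge `srVar_format` and `toRat_roundDown/Up`).
* `EnvelopeSRAtoms.srRelVarSharp` — L8 VERBATIM (idea-2, `envelope/LEAN-CANDIDATES-v2.lean.txt`):
  the one-step expectation operator `step (valueSet φ) x (fun y => (y - x)^2) ≤ u²/(1+2u) · x²`;
  `mxVarRelSharp` — the block-scaled element `E (s·SR(v/s) − v)² ≤ u²/(1+2u) · v²` for an element
  normal after scaling; the constants `1/288, 1/80, 1/24`; TIGHTNESS at `18/17, 10/9, 6/5` by kernel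
  evaluation of the directed roundings; and `(u/(1+u))² < u²/(1+2u)`.

References: [ArarEtAl2023] §3 (two-point variance `V = (x − ⌊x⌋)(⌈x⌉ − x) ≤ x²u²/4` with their
`u = 2^{1-p}`, i.e. `u²·x²` here — the coarse level); [ConnollyHighamMary2021] Lemma 4.4, §5;
[Higham2002ASNA] Thm 2.2 (the RNE analogue `u/(1+u)`); [JeannerodRump2018] eq. (1.2).  The sharp
SR constant `u²/(1+2u)` with its extremal point is, as far as the cell's literature search found
(`envelope/FRESHNESS-ENUM.md` gen37), not stated in print; it is elementary and we make no priority
claim beyond "not found".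

Placement: venture development under `Summits/Ventures/CertifiedArithmetic/`; grid/datum statements
extend the Literature structures `Format` / `MiniFloat` by dot notation (CONVENTIONS §2); the
operator-level atoms live in `Summit.Ventures.CertifiedArithmetic.LowPrec.EnvelopeSRAtoms`.
-/

namespace Literature.ComputerArithmetic.FloatingPoint

open Literature.ComputerArithmetic

namespace Format

variable {φ : Format}

/-- SHARP SR VARIANCE ON THE MAGNITUDE GRID: for `2^m ≤ r ≤ maxScaled` (normal range in quanta),
`(r − rdGrid r)(ruGrid r − r) ≤ u²/(1+2u) · r²`. [folklore] -/
theorem sub_rdGrid_mul_ruGrid_sub_le_sharp {r : ℚ} (hrm : (2 : ℚ) ^ φ.manBits ≤ r)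
    (hle : r ≤ φ.maxScaled) :
    (r - φ.rdGrid r) * ((φ.ruGrid r : ℚ) - r)
      ≤ φ.unitRoundoff ^ 2 / (1 + 2 * φ.unitRoundoff) * r ^ 2 := by
  have hu := φ.unitRoundoff_pos
  have hr : 0 ≤ r := le_trans (by positivity) hrm
  -- the floor g = 2^(m+s) of the input binade
  have hfloor : (2 : ℚ) ^ (φ.manBits + φ.shift ⌊r⌋.toNat) ≤ r := by
    rcases shift_floor_dichotomy (φ := φ) hr with hs | hfl
    · rw [hs, add_zero]; exact hrm
    · exact hfl
  have hgap := ruGrid_sub_rdGrid_le (φ := φ) hr hle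
  have hd := rdGrid_le (φ := φ) hr
  have hU := le_ruGrid (φ := φ) hle
  set s := φ.shift ⌊r⌋.toNat with hs_def
  set g : ℚ := (2 : ℚ) ^ (φ.manBits + s) with hg
  -- g is representable, hence below the round-down value d
  have hgrep : φ.Representable ((2 ^ φ.manBits + 0) * 2 ^ s) := by
    refine MiniFloat.representable_mul_pow
      (by have := Nat.two_pow_pos φ.manBits; rw [pow_succ]; omega) ?_
    have : ((2 ^ (φ.manBits + s) : ℕ) : ℚ) ≤ φ.maxScaled := by push_cast; exact le_trans hfloor hle
    have h' : 2 ^ (φ.manBits + s) ≤ φ.maxScaled := by exact_mod_cast this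
    simpa [pow_add] using h'
  have e : (((2 ^ φ.manBits + 0) * 2 ^ s : ℕ) : ℚ) = g := by rw [hg]; push_cast; ring
  have hgd : g ≤ (φ.rdGrid r : ℚ) := by
    have h1 := le_rdGrid_of_le hr hgrep (by rw [e]; exact hfloor)
    have h2 : (((2 ^ φ.manBits + 0) * 2 ^ s : ℕ) : ℚ) ≤ (φ.rdGrid r : ℚ) := by exact_mod_cast h1
    rwa [e] at h2
  -- the local spacing is 2^s = 2u·g ≤ 2u·d
  have hug : (2 : ℚ) ^ s = 2 * φ.unitRoundoff * g := by
    rw [unitRoundoff_eq, hg]; field_simp; ring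
  have hw : (φ.ruGrid r : ℚ) - φ.rdGrid r ≤ 2 * φ.unitRoundoff * φ.rdGrid r :=
    calc (φ.ruGrid r : ℚ) - φ.rdGrid r ≤ 2 ^ s := hgap
      _ = 2 * φ.unitRoundoff * g := hug
      _ ≤ 2 * φ.unitRoundoff * φ.rdGrid r := mul_le_mul_of_nonneg_left hgd (by positivity)
  -- u²(d+a)² − (1+2u)ab = (ud − (1+u)a)² + (1+2u)a(2ud − a − b)
  rw [div_mul_eq_mul_div, le_div_iff₀ (by positivity)]
  nlinarith [sq_nonneg (φ.unitRoundoff * φ.rdGrid r - (1 + φ.unitRoundoff) * (r - φ.rdGrid r)),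
    mul_nonneg (mul_nonneg (by positivity : (0 : ℚ) ≤ 1 + 2 * φ.unitRoundoff) (sub_nonneg.mpr hd))
      (by linarith : (0 : ℚ) ≤ 2 * φ.unitRoundoff * φ.rdGrid r - ((φ.ruGrid r : ℚ) - φ.rdGrid r))]

/-- For every positive unit roundoff the squared round-to-nearest atom is below the SR variance
atom: `(u/(1+u))² < u²/(1+2u)`. [folklore] -/
theorem sharpRNE_sq_lt_sharpSR (φ : Format) :
    (φ.unitRoundoff / (1 + φ.unitRoundoff)) ^ 2 < φ.unitRoundoff ^ 2 / (1 + 2 * φ.unitRoundoff) := by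
  have hu := φ.unitRoundoff_pos
  have h1 : (0 : ℚ) < 1 + φ.unitRoundoff := by linarith
  have h2 : (0 : ℚ) < 1 + 2 * φ.unitRoundoff := by linarith
  rw [← sub_pos]
  have e : φ.unitRoundoff ^ 2 / (1 + 2 * φ.unitRoundoff) - (φ.unitRoundoff / (1 + φ.unitRoundoff)) ^ 2
      = φ.unitRoundoff ^ 4 / ((1 + 2 * φ.unitRoundoff) * (1 + φ.unitRoundoff) ^ 2) := by
    field_simp
    ring
  rw [e]
  positivity

end Format

namespace MiniFloat

variable {φ : Format}

/-- SHARP RELATIVE VARIANCE OF STOCHASTIC ROUNDING (every format): on the normal range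
`2^m · quantum ≤ |x| ≤ maxRat`, `Var SR(x) = (x − ↓x)(↑x − x) ≤ u²/(1+2u) · x²`.
[cite: ArarEtAl2023, §3] -/
theorem srVar_le_sharp {x : ℚ} (hlo : 2 ^ φ.manBits * φ.quantum ≤ |x|) (hhi : |x| ≤ φ.maxRat) :
    ConnollyHighamMary2021.srVar (valueSet φ) x
      ≤ φ.unitRoundoff ^ 2 / (1 + 2 * φ.unitRoundoff) * x ^ 2 := by
  have hq := φ.quantum_pos
  set r := |x| / φ.quantum with hr_def
  have hxr : |x| = r * φ.quantum := by rw [hr_def, div_mul_cancel₀ _ (ne_of_gt hq)]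
  have hle : r ≤ φ.maxScaled := by rw [hr_def, div_le_iff₀ hq]; exact hhi
  have hrm : (2 : ℚ) ^ φ.manBits ≤ r := by rw [hr_def, le_div_iff₀ hq]; exact hlo
  have key := Format.sub_rdGrid_mul_ruGrid_sub_le_sharp hrm hle
  have key2 := mul_le_mul_of_nonneg_right key (sq_nonneg φ.quantum)
  have hx2 : x ^ 2 = r ^ 2 * φ.quantum ^ 2 := by rw [← sq_abs x, hxr]; ring
  rw [srVar_format hhi, toRat_roundDown, toRat_roundUp, ← hr_def, hx2]
  split_ifs with hneg
  · have hx : x = -(r * φ.quantum) := by rw [← hxr, abs_of_neg hneg, neg_neg]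
    rw [hx]
    nlinarith [key2]
  · have hx : x = r * φ.quantum := by rw [← hxr, abs_of_nonneg (not_lt.mp hneg)]
    rw [hx]
    nlinarith [key2]

end MiniFloat

end Literature.ComputerArithmetic.FloatingPoint

namespace Summit.Ventures.CertifiedArithmetic.LowPrec.EnvelopeSRAtoms

open Literature.ComputerArithmetic.ConnollyHighamMary2021 (srVar)
open Literature.ComputerArithmetic.FloatingPoint
open Literature.ComputerArithmetic.FloatingPoint.Format
open Summit.Ventures.CertifiedArithmetic.LowPrec.SR

/-- In range, the one-step second moment about the input IS El Arar et al.'s variance: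
`E (SR(x) − x)² = v(x)` (the mean is `x`, CHM Lemma 4.4). [cite: ConnollyHighamMary2021, Lemma 4.4] -/
theorem step_sq_sub_eq_srVar (φ : Format) {x : ℚ} (hhi : |x| ≤ φ.maxRat) :
    step (MiniFloat.valueSet φ) x (fun y => (y - x) ^ 2) = srVar (MiniFloat.valueSet φ) x := by
  have hc : InHull (MiniFloat.valueSet φ) x := (valueSet_inHull_iff φ x).mpr hhi
  have hfun : (fun y : ℚ => (y - x) ^ 2) = (fun t => (t + -x) ^ 2) := by
    funext t; rw [sub_eq_add_neg]
  rw [hfun, step_sq_add, clamp_eq_self hc, add_neg_cancel, zero_pow two_ne_zero, add_zero]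

/-- L8 `SRRelVarSharp` of the cell's LEAN-CANDIDATES-v2, VERBATIM: for every format and every
rational in its normal range, one stochastic rounding into the format has second moment about the
input at most `u²/(1+2u) · x²`. [cite: ArarEtAl2023, §3] -/
theorem srRelVarSharp :
    ∀ (φ : Format) (x : ℚ), 2 ^ φ.manBits * φ.quantum ≤ |x| → |x| ≤ φ.maxRat →
      step (MiniFloat.valueSet φ) x (fun y => (y - x) ^ 2)
        ≤ φ.unitRoundoff ^ 2 / (1 + 2 * φ.unitRoundoff) * x ^ 2 := by
  intro φ x hlo hhi
  rw [step_sq_sub_eq_srVar φ hhi]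
  exact MiniFloat.srVar_le_sharp hlo hhi

/-- BLOCK-SCALED ELEMENT (MX / per-vector scale `s > 0`, SR element): if the element does not clip
(`|v| ≤ s · maxRat`) and is normal after scaling (`s · 2^m · quantum ≤ |v|`), then
`E (s · SR(v/s) − v)² ≤ u²/(1+2u) · v²` — the per-binade `relself` atom of C57 on all-normal cells.
[cite: RouhaniEtAl2023MX, §3] -/
theorem mxVarRelSharp {φ : Format} {s v : ℚ} (hs : 0 < s) (hv : |v| ≤ s * φ.maxRat)
    (hlo : s * (2 ^ φ.manBits * φ.quantum) ≤ |v|) :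
    scaledStep (MiniFloat.valueSet φ) s v (fun y => (y - v) ^ 2)
      ≤ φ.unitRoundoff ^ 2 / (1 + 2 * φ.unitRoundoff) * v ^ 2 := by
  have hs0 : s ≠ 0 := ne_of_gt hs
  rw [mx_var_eq hs hv]
  have habs : |v / s| = |v| / s := by rw [abs_div, abs_of_pos hs]
  have h1 : 2 ^ φ.manBits * φ.quantum ≤ |v / s| := by
    rw [habs, le_div_iff₀ hs, mul_comm]; exact hlo
  have h2 : |v / s| ≤ φ.maxRat := by rw [habs, div_le_iff₀ hs, mul_comm]; exact hv
  have h := MiniFloat.srVar_le_sharp h1 h2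
  calc s ^ 2 * srVar (MiniFloat.valueSet φ) (v / s)
      ≤ s ^ 2 * (φ.unitRoundoff ^ 2 / (1 + 2 * φ.unitRoundoff) * (v / s) ^ 2) :=
        mul_le_mul_of_nonneg_left h (sq_nonneg s)
    _ = φ.unitRoundoff ^ 2 / (1 + 2 * φ.unitRoundoff) * v ^ 2 := by
        field_simp

/-- The SR variance atom `u²/(1+2u)` of the three element formats of the envelope tables:
`1/288` (E4M3, `u = 1/16`), `1/80` (E5M2, `u = 1/8`), `1/24` (E2M1, `u = 1/4`) — the all-normal
`relself` cells of certificate C57. [cite: MicikeviciusEtAl2022, Table 1] -/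
theorem sharpSRUnit_values :
    E4M3.unitRoundoff ^ 2 / (1 + 2 * E4M3.unitRoundoff) = 1 / 288 ∧
    E5M2.unitRoundoff ^ 2 / (1 + 2 * E5M2.unitRoundoff) = 1 / 80 ∧
    E2M1.unitRoundoff ^ 2 / (1 + 2 * E2M1.unitRoundoff) = 1 / 24 := by
  refine ⟨by decide +kernel, by decide +kernel, by decide +kernel⟩

/-- The extremal points `x* = (1+2u)/(1+u)` of the first normal-or-not binade `[1, 2)`:
directed roundings `↓x* = 1`, `↑x* = 1 + 2u` (kernel evaluation) and the variance
`(x* − 1)(1 + 2u − x*) = u²/(1+2u) · x*²` EXACTLY — E4M3 `18/17 ↦ 9/2312`, E5M2 `10/9 ↦ 5/324`,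
E2M1 `6/5 ↦ 3/50`; the C57 route-B-2 witnesses (e.g. E4M3 `4608/17 = 2^8 · 18/17`).
[cite: ArarEtAl2023, §3] -/
theorem srVar_sharp_witnesses :
    srVar (MiniFloat.valueSet E4M3) (18 / 17) = 1 / 288 * (18 / 17) ^ 2 ∧
    srVar (MiniFloat.valueSet E5M2) (10 / 9) = 1 / 80 * (10 / 9) ^ 2 ∧
    srVar (MiniFloat.valueSet E2M1) (6 / 5) = 1 / 24 * (6 / 5) ^ 2 := by
  refine ⟨?_, ?_, ?_⟩
  · rw [MiniFloat.srVar_format (φ := E4M3) (by decide +kernel),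
      show (roundDown E4M3 (18 / 17)).toRat = 1 by decide +kernel,
      show (roundUp E4M3 (18 / 17)).toRat = 9 / 8 by decide +kernel]
    norm_num
  · rw [MiniFloat.srVar_format (φ := E5M2) (by decide +kernel),
      show (roundDown E5M2 (10 / 9)).toRat = 1 by decide +kernel,
      show (roundUp E5M2 (10 / 9)).toRat = 5 / 4 by decide +kernel]
    norm_num
  · rw [MiniFloat.srVar_format (φ := E2M1) (by decide +kernel),
      show (roundDown E2M1 (6 / 5)).toRat = 1 by decide +kernel,
      show (roundUp E2M1 (6 / 5)).toRat = 3 / 2 by decide +kernel]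
    norm_num

/-- TIGHTNESS of L8 for the three OCP element formats: equality in `srRelVarSharp` at
`x = 18/17` (E4M3), `10/9` (E5M2), `6/5` (E2M1). [cite: ArarEtAl2023, §3] -/
theorem srRelVarSharp_attained :
    step (MiniFloat.valueSet E4M3) (18 / 17) (fun y => (y - 18 / 17) ^ 2)
      = E4M3.unitRoundoff ^ 2 / (1 + 2 * E4M3.unitRoundoff) * (18 / 17) ^ 2 ∧
    step (MiniFloat.valueSet E5M2) (10 / 9) (fun y => (y - 10 / 9) ^ 2)
      = E5M2.unitRoundoff ^ 2 / (1 + 2 * E5M2.unitRoundoff) * (10 / 9) ^ 2 ∧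
    step (MiniFloat.valueSet E2M1) (6 / 5) (fun y => (y - 6 / 5) ^ 2)
      = E2M1.unitRoundoff ^ 2 / (1 + 2 * E2M1.unitRoundoff) * (6 / 5) ^ 2 := by
  obtain ⟨c1, c2, c3⟩ := sharpSRUnit_values
  obtain ⟨w1, w2, w3⟩ := srVar_sharp_witnesses
  refine ⟨?_, ?_, ?_⟩
  · rw [step_sq_sub_eq_srVar E4M3 (by decide +kernel), c1, w1]
  · rw [step_sq_sub_eq_srVar E5M2 (by decide +kernel), c2, w2]
  · rw [step_sq_sub_eq_srVar E2M1 (by decide +kernel), c3, w3]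

end Summit.Ventures.CertifiedArithmetic.LowPrec.EnvelopeSRAtoms
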